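import Summits.BirchSwinnertonDyer.BirchSwinnertonDyer.Theorems.PrintCf2RubinValueTwoBrickCD4ChiLayerKleinFour
import Literature.NumberTheory.NumberFields.RayClassFieldSupConductor
import HarnessLib

/-!
# Brick (c) at `p = 2`, module M-DEPL (arithmetic, D8b): the layer `S_{m+1}/S_m` of the symmetric two-prime tower `S_m = K(𝔤₀v̄^ν·v̄^{m+1}v^{m+ν+1})`
# is a `(ℤ/2)²`-extension — `[S_{m+1}:S_m] = 4`, `S_{m+1} = S_m(v) ⊔ S_m(v̄)`, every `σ ∈ Gal(S_{m+1}/S_m)` has `σ² = 1`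

Cell `bsd-print-cf2`, width seat `bsd-line-cf2c-w7` g28, route C `PrintCf2RubinValueTwo`, crux of record stmt-BirchSwinnertonDyer-24033
`TwoVariableMainConjAtSplitTwoQuad` (23720 nominal), BRICK §4(c); memo v8 `Cruxes/TwoVariableMainConjAtSplitTwoQuad/BRICK-C-D4CHI-g28.md` §0 (C), §2 (C-asm, D8b).
`--supports` the crux as a helper.  THEOREMS ONLY (0 sorry, no definition, no named fact).

* `finrank_rayClassField_mul_pow_succ_succ_eq`, ★ `finrank_rayClassField_twoPrimes_steps` — the three degree-`p` steps `[K(Av):K]`, `[K(Av̄):K]`, `[K(Avv̄):K]`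
  (de Shalit II.1.9 at `v` and at `v̄`, both of degree one over the split prime `p`); `finrank_eq_of_finrank_eq_mul`.
* ★★ `finrank_layer_eq_four_and_mul_self_eq_one` — `[S_{m+1} : S_m] = 4` and exponent `2` (`K(Av) ⊓ K(Av̄) = K(A)` by Neukirch VI (6.1), so the two quadratic
  steps are distinct and generate; `…LayerKleinFour.algEquiv_mul_self_eq_one_of_le_sup`).
BSD is not proved by any of this; nothing here closes 24033 or 27037.

## References
* [Rubin1991] K. Rubin, *The "main conjectures" of Iwasawa theory for imaginary quadratic fields*, Invent. Math. 103 (1991), §1 pp. 28–29, §4 p. 36.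
* [deShalit1987] E. de Shalit, *Iwasawa theory of elliptic curves with complex multiplication* (1987), II.1.9, II.2.4–2.5, III §1.3–1.4 (p. 88–91).
* [Washington1997] L. C. Washington, *Introduction to Cyclotomic Fields* (1997), §13.3.
* [NeukirchANT1999] J. Neukirch, *Algebraic Number Theory* (1999), Ch. IV §1, Ch. VI §6 (6.1)–(6.2).
-/

noncomputable section

set_option linter.dupNamespace false
set_option autoImplicit false

open scoped Classical
open NumberField IsDedekindDomain Field IntermediateField
open Literature.NumberTheory.NumberFields
open Literature.NumberTheory.GaloisRepresentations Literature.NumberTheory.GaloisRepresentations.LocalWeilDatum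
open Literature.NumberTheory.ComplexMultiplication.EllipticUnits
open Literature.NumberTheory.EllipticCurves
open Summit.BirchSwinnertonDyer.BirchSwinnertonDyer.Theorems.PrintCf2.LeopoldtAtV

namespace Summit.BirchSwinnertonDyer.BirchSwinnertonDyer.Theorems.PrintCf2.BrickCD4Chi

variable {K : Type} [Field K] [NumberField K]

/-! ### §4. The symmetric two-prime tower `S_m = K(𝔤₀ v̄^ν · v̄^{m+1} v^{m+ν+1})` -/

section Tower

open IsDedekindDomain.HeightOneSpectrum

variable {p : ℕ} [hp : Fact p.Prime] {v v' : HeightOneSpectrum (𝓞 K)} {𝔤₀ : Ideal (𝓞 K)}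

/-- One step `K(𝔣𝔭^{n+1}) ≤ K(𝔣𝔭^{n+2})` multiplies the absolute degree by `p` (`𝔭` of degree one, unramified, `𝔣` prime to `𝔭`, `w_{𝔣𝔭} = 1`).
[cite: deShalit1987, II.1.9 (p. 43)] -/
theorem finrank_rayClassField_mul_pow_succ_succ_eq [IsTotallyComplex K] (v : HeightOneSpectrum (𝓞 K)) (hdeg : Nat.card (𝓞 K ⧸ v.asIdeal) = p)
    (hval : v.intValuation ((p : ℕ) : 𝓞 K) = WithZero.exp (-1 : ℤ)) {𝔣 : Ideal (𝓞 K)} (h𝔣 : 𝔣 ≠ ⊥) (hcop : IsCoprime 𝔣 v.asIdeal)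
    (hw : ∀ u : (𝓞 K)ˣ, (u : 𝓞 K) - 1 ∈ 𝔣 * v.asIdeal → u = 1) (n : ℕ) :
    Module.finrank K (rayClassField K (𝔣 * v.asIdeal ^ (n + 2))) = p * Module.finrank K (rayClassField K (𝔣 * v.asIdeal ^ (n + 1))) := by
  rw [show n + 2 = n + 1 + 1 from rfl, finrank_rayClassField_mul_pow_succ_eq v hdeg hval h𝔣 hcop hw (n + 1),
    finrank_rayClassField_mul_pow_succ_eq v hdeg hval h𝔣 hcop hw n, pow_succ]
  ring

variable (hK : IsImaginaryQuadratic K) (hpv : (p : 𝓞 K) ∈ v.asIdeal) (hpv' : (p : 𝓞 K) ∈ v'.asIdeal) (hvv' : v' ≠ v)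
  (h𝔤0 : 𝔤₀ ≠ ⊥) (hv : ¬ 𝔤₀ ≤ v.asIdeal) (hv' : ¬ 𝔤₀ ≤ v'.asIdeal) (hw𝔤 : ∀ u : (𝓞 K)ˣ, (u : 𝓞 K) - 1 ∈ 𝔤₀ → u = 1) (ν m : ℕ)

include hK hpv hpv' hvv' h𝔤0 hv hv' hw𝔤 in
/-- ★ **The three degrees of the layer**: with `A = 𝔤₀v̄^ν v̄^{m+1}v^{m+ν+1}` (`S_m`), `B = A·v` (`T`), `B' = A·v̄` (`T'`), `C = A·v v̄` (`S_{m+1}`):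
`[K(B):K] = p[K(A):K]`, `[K(B'):K] = p[K(A):K]`, `[K(C):K] = p[K(B):K]` (de Shalit II.1.9 at `v` and at `v̄`, both of degree one over the split `p`).
[cite: deShalit1987, II.1.9 (p. 43)] [cite: NeukirchANT1999, Ch. VI §6 (6.2)] -/
theorem finrank_rayClassField_twoPrimes_steps :
    Module.finrank K (rayClassField K (𝔤₀ * v'.asIdeal ^ ν * v'.asIdeal ^ (m + 1) * v.asIdeal ^ (m + ν + 2))) =
        p * Module.finrank K (rayClassField K (𝔤₀ * v'.asIdeal ^ ν * v'.asIdeal ^ (m + 1) * v.asIdeal ^ (m + ν + 1))) ∧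
      Module.finrank K (rayClassField K (𝔤₀ * v'.asIdeal ^ ν * v'.asIdeal ^ (m + 2) * v.asIdeal ^ (m + ν + 1))) =
        p * Module.finrank K (rayClassField K (𝔤₀ * v'.asIdeal ^ ν * v'.asIdeal ^ (m + 1) * v.asIdeal ^ (m + ν + 1))) ∧
      Module.finrank K (rayClassField K (𝔤₀ * v'.asIdeal ^ ν * v'.asIdeal ^ (m + 2) * v.asIdeal ^ (m + ν + 2))) =
        p * Module.finrank K (rayClassField K (𝔤₀ * v'.asIdeal ^ ν * v'.asIdeal ^ (m + 1) * v.asIdeal ^ (m + ν + 2))) := by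
  haveI := hK.isTotallyComplex
  have hpv1 : ((p : ℕ) : 𝓞 K) ∈ v.asIdeal := by exact_mod_cast hpv
  have hpv1' : ((p : ℕ) : 𝓞 K) ∈ v'.asIdeal := by exact_mod_cast hpv'
  have hdegv := natCard_quotient_eq_of_mem_of_mem_of_ne hK.1 hp.out hpv1 hpv1' hvv'
  have hvalv := intValuation_natCast_eq_of_mem_of_mem_of_ne hK.1 hp.out hpv1 hpv1' hvv'
  have hdegv' := natCard_quotient_eq_of_mem_of_mem_of_ne hK.1 hp.out hpv1' hpv1 hvv'.symm
  have hvalv' := intValuation_natCast_eq_of_mem_of_mem_of_ne hK.1 hp.out hpv1' hpv1 hvv'.symm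
  have hcv : IsCoprime 𝔤₀ v.asIdeal := (Ideal.isCoprime_iff_sup_eq.mpr
    (v.isMaximal.1.2 _ (lt_of_le_of_ne le_sup_right fun e ↦ hv (e ▸ le_sup_left))))
  have hcv' : IsCoprime 𝔤₀ v'.asIdeal := (Ideal.isCoprime_iff_sup_eq.mpr
    (v'.isMaximal.1.2 _ (lt_of_le_of_ne le_sup_right fun e ↦ hv' (e ▸ le_sup_left))))
  have hvv'c : IsCoprime v'.asIdeal v.asIdeal := by
    rw [Ideal.isCoprime_iff_sup_eq]
    exact v'.isMaximal.coprime_of_ne v.isMaximal fun e ↦ hvv' (HeightOneSpectrum.ext e)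
  refine ⟨?_, ?_, ?_⟩
  · -- `v`-step over `𝔣₁ = 𝔤₀ v̄^ν v̄^{m+1}`
    have h𝔣 : 𝔤₀ * v'.asIdeal ^ ν * v'.asIdeal ^ (m + 1) ≠ ⊥ := mul_ne_zero (mul_ne_zero h𝔤0 (pow_ne_zero _ v'.ne_bot)) (pow_ne_zero _ v'.ne_bot)
    have hcop : IsCoprime (𝔤₀ * v'.asIdeal ^ ν * v'.asIdeal ^ (m + 1)) v.asIdeal :=
      (hcv.mul_left (IsCoprime.pow_left hvv'c)).mul_left (IsCoprime.pow_left hvv'c)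
    have hw : ∀ u : (𝓞 K)ˣ, (u : 𝓞 K) - 1 ∈ 𝔤₀ * v'.asIdeal ^ ν * v'.asIdeal ^ (m + 1) * v.asIdeal → u = 1 :=
      fun u hu ↦ hw𝔤 u ((Ideal.mul_le_right.trans (Ideal.mul_le_right.trans Ideal.mul_le_right)) hu)
    exact finrank_rayClassField_mul_pow_succ_succ_eq v hdegv hvalv h𝔣 hcop hw (m + ν)
  · -- `v̄`-step over `𝔣₂ = 𝔤₀ v^{m+ν+1}`
    have e1 : 𝔤₀ * v'.asIdeal ^ ν * v'.asIdeal ^ (m + 1) * v.asIdeal ^ (m + ν + 1) = (𝔤₀ * v.asIdeal ^ (m + ν + 1)) * v'.asIdeal ^ (ν + m + 1) := by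
      rw [show ν + m + 1 = ν + (m + 1) by ring, pow_add]; ring
    have e2 : 𝔤₀ * v'.asIdeal ^ ν * v'.asIdeal ^ (m + 2) * v.asIdeal ^ (m + ν + 1) = (𝔤₀ * v.asIdeal ^ (m + ν + 1)) * v'.asIdeal ^ (ν + m + 2) := by
      rw [show ν + m + 2 = ν + (m + 2) by ring, pow_add]; ring
    have h𝔣 : 𝔤₀ * v.asIdeal ^ (m + ν + 1) ≠ ⊥ := mul_ne_zero h𝔤0 (pow_ne_zero _ v.ne_bot)
    have hcop : IsCoprime (𝔤₀ * v.asIdeal ^ (m + ν + 1)) v'.asIdeal := hcv'.mul_left (IsCoprime.pow_left hvv'c.symm)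
    have hw : ∀ u : (𝓞 K)ˣ, (u : 𝓞 K) - 1 ∈ 𝔤₀ * v.asIdeal ^ (m + ν + 1) * v'.asIdeal → u = 1 :=
      fun u hu ↦ hw𝔤 u ((Ideal.mul_le_right.trans Ideal.mul_le_right) hu)
    rw [e1, e2]
    exact finrank_rayClassField_mul_pow_succ_succ_eq v' hdegv' hvalv' h𝔣 hcop hw (ν + m)
  · -- `v̄`-step over `𝔣₃ = 𝔤₀ v^{m+ν+2}`
    have e1 : 𝔤₀ * v'.asIdeal ^ ν * v'.asIdeal ^ (m + 1) * v.asIdeal ^ (m + ν + 2) = (𝔤₀ * v.asIdeal ^ (m + ν + 2)) * v'.asIdeal ^ (ν + m + 1) := by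
      rw [show ν + m + 1 = ν + (m + 1) by ring, pow_add]; ring
    have e2 : 𝔤₀ * v'.asIdeal ^ ν * v'.asIdeal ^ (m + 2) * v.asIdeal ^ (m + ν + 2) = (𝔤₀ * v.asIdeal ^ (m + ν + 2)) * v'.asIdeal ^ (ν + m + 2) := by
      rw [show ν + m + 2 = ν + (m + 2) by ring, pow_add]; ring
    have h𝔣 : 𝔤₀ * v.asIdeal ^ (m + ν + 2) ≠ ⊥ := mul_ne_zero h𝔤0 (pow_ne_zero _ v.ne_bot)
    have hcop : IsCoprime (𝔤₀ * v.asIdeal ^ (m + ν + 2)) v'.asIdeal := hcv'.mul_left (IsCoprime.pow_left hvv'c.symm)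
    have hw : ∀ u : (𝓞 K)ˣ, (u : 𝓞 K) - 1 ∈ 𝔤₀ * v.asIdeal ^ (m + ν + 2) * v'.asIdeal → u = 1 :=
      fun u hu ↦ hw𝔤 u ((Ideal.mul_le_right.trans Ideal.mul_le_right) hu)
    rw [e1, e2]
    exact finrank_rayClassField_mul_pow_succ_succ_eq v' hdegv' hvalv' h𝔣 hcop hw (ν + m)

omit [NumberField K] in
/-- `[L : F] = [L : K] / [F : K]` bookkeeping: if `[L:K] = r·[F:K]` for `F ≤ L` then `finrank F L = r`. [cite: NeukirchANT1999, Ch. IV §1] -/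
theorem finrank_eq_of_finrank_eq_mul {F L : IntermediateField K (AlgebraicClosure K)} (hFL : F ≤ L) [FiniteDimensional K L] {r : ℕ}
    (hr : Module.finrank K L = r * Module.finrank K F) :
    letI := (IntermediateField.inclusion hFL).toRingHom.toAlgebra
    Module.finrank F L = r := by
  letI := (IntermediateField.inclusion hFL).toRingHom.toAlgebra
  haveI : IsScalarTower K F L := isScalarTower_inclusion hFL
  haveI : FiniteDimensional K F := Literature.NumberTheory.NumberFields.finiteDimensional_of_le hFL
  have e := Module.finrank_mul_finrank K F L
  rw [hr, mul_comm r] at e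
  exact Nat.eq_of_mul_eq_mul_left Module.finrank_pos e

include hK hpv hpv' hvv' h𝔤0 hv hv' hw𝔤 in
/-- ★★ **The layer `S_{m+1}/S_m` is a `(ℤ/2)²`-extension** (`p = 2`): `[S_{m+1} : S_m] = 4`, and every `σ ∈ Gal(S_{m+1}/S_m)` has `σ² = 1` — `S_{m+1} = T ⊔ T'`
with `T = S_m(v) = K(A·v)`, `T' = K(A·v̄)` the two quadratic steps (`T ⊓ T' = K(gcd) = S_m` by Neukirch VI (6.1), so `T ≠ T'` and the compositum is everything by degrees).
[cite: deShalit1987, II.1.9 (p. 43)] [cite: NeukirchANT1999, Ch. VI §6 Thm. (6.1), Def. (6.2)] [cite: Washington1997, §13.3] -/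
theorem finrank_layer_eq_four_and_mul_self_eq_one (hp2 : p = 2)
    (hle : rayClassField K (𝔤₀ * v'.asIdeal ^ ν * v'.asIdeal ^ (m + 1) * v.asIdeal ^ (m + ν + 1)) ≤ rayClassField K (𝔤₀ * v'.asIdeal ^ ν * v'.asIdeal ^ (m + 2) * v.asIdeal ^ (m + ν + 2))) :
    letI := (IntermediateField.inclusion hle).toRingHom.toAlgebra
    Module.finrank ↥(rayClassField K (𝔤₀ * v'.asIdeal ^ ν * v'.asIdeal ^ (m + 1) * v.asIdeal ^ (m + ν + 1))) ↥(rayClassField K (𝔤₀ * v'.asIdeal ^ ν * v'.asIdeal ^ (m + 2) * v.asIdeal ^ (m + ν + 2))) = 4 ∧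
      ∀ σ : ↥(rayClassField K (𝔤₀ * v'.asIdeal ^ ν * v'.asIdeal ^ (m + 2) * v.asIdeal ^ (m + ν + 2))) ≃ₐ[↥(rayClassField K (𝔤₀ * v'.asIdeal ^ ν * v'.asIdeal ^ (m + 1) * v.asIdeal ^ (m + ν + 1)))] ↥(rayClassField K (𝔤₀ * v'.asIdeal ^ ν * v'.asIdeal ^ (m + 2) * v.asIdeal ^ (m + ν + 2))), σ * σ = 1 := by
  obtain ⟨h1, h2, h3⟩ := finrank_rayClassField_twoPrimes_steps hK hpv hpv' hvv' h𝔤0 hv hv' hw𝔤 ν m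
  subst hp2
  -- the ideals
  have hA0 : (𝔤₀ * v'.asIdeal ^ ν * v'.asIdeal ^ (m + 1) * v.asIdeal ^ (m + ν + 1)) ≠ ⊥ :=
    mul_ne_zero (mul_ne_zero (mul_ne_zero h𝔤0 (pow_ne_zero _ v'.ne_bot)) (pow_ne_zero _ v'.ne_bot)) (pow_ne_zero _ v.ne_bot)
  have hB0 : (𝔤₀ * v'.asIdeal ^ ν * v'.asIdeal ^ (m + 1) * v.asIdeal ^ (m + ν + 2)) ≠ ⊥ :=
    mul_ne_zero (mul_ne_zero (mul_ne_zero h𝔤0 (pow_ne_zero _ v'.ne_bot)) (pow_ne_zero _ v'.ne_bot)) (pow_ne_zero _ v.ne_bot)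
  have hB'0 : (𝔤₀ * v'.asIdeal ^ ν * v'.asIdeal ^ (m + 2) * v.asIdeal ^ (m + ν + 1)) ≠ ⊥ :=
    mul_ne_zero (mul_ne_zero (mul_ne_zero h𝔤0 (pow_ne_zero _ v'.ne_bot)) (pow_ne_zero _ v'.ne_bot)) (pow_ne_zero _ v.ne_bot)
  have hC0 : (𝔤₀ * v'.asIdeal ^ ν * v'.asIdeal ^ (m + 2) * v.asIdeal ^ (m + ν + 2)) ≠ ⊥ :=
    mul_ne_zero (mul_ne_zero (mul_ne_zero h𝔤0 (pow_ne_zero _ v'.ne_bot)) (pow_ne_zero _ v'.ne_bot)) (pow_ne_zero _ v.ne_bot)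
  have eB : (𝔤₀ * v'.asIdeal ^ ν * v'.asIdeal ^ (m + 1) * v.asIdeal ^ (m + ν + 2)) = (𝔤₀ * v'.asIdeal ^ ν * v'.asIdeal ^ (m + 1) * v.asIdeal ^ (m + ν + 1)) * v.asIdeal := by
    rw [show m + ν + 2 = m + ν + 1 + 1 from rfl, pow_succ v.asIdeal (m + ν + 1)]; ring
  have eB' : (𝔤₀ * v'.asIdeal ^ ν * v'.asIdeal ^ (m + 2) * v.asIdeal ^ (m + ν + 1)) = (𝔤₀ * v'.asIdeal ^ ν * v'.asIdeal ^ (m + 1) * v.asIdeal ^ (m + ν + 1)) * v'.asIdeal := by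
    rw [show m + 2 = m + 1 + 1 from rfl, pow_succ v'.asIdeal (m + 1)]; ring
  have eCB : (𝔤₀ * v'.asIdeal ^ ν * v'.asIdeal ^ (m + 2) * v.asIdeal ^ (m + ν + 2)) = (𝔤₀ * v'.asIdeal ^ ν * v'.asIdeal ^ (m + 1) * v.asIdeal ^ (m + ν + 2)) * v'.asIdeal := by
    rw [show m + 2 = m + 1 + 1 from rfl, pow_succ v'.asIdeal (m + 1)]; ring
  have eCB' : (𝔤₀ * v'.asIdeal ^ ν * v'.asIdeal ^ (m + 2) * v.asIdeal ^ (m + ν + 2)) = (𝔤₀ * v'.asIdeal ^ ν * v'.asIdeal ^ (m + 2) * v.asIdeal ^ (m + ν + 1)) * v.asIdeal := by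
    rw [show m + ν + 2 = m + ν + 1 + 1 from rfl, pow_succ v.asIdeal (m + ν + 1)]; ring
  have hAB : rayClassField K (𝔤₀ * v'.asIdeal ^ ν * v'.asIdeal ^ (m + 1) * v.asIdeal ^ (m + ν + 1)) ≤ rayClassField K (𝔤₀ * v'.asIdeal ^ ν * v'.asIdeal ^ (m + 1) * v.asIdeal ^ (m + ν + 2)) := rayClassField_le_of_le hB0 (eB ▸ Ideal.mul_le_right)
  have hAB' : rayClassField K (𝔤₀ * v'.asIdeal ^ ν * v'.asIdeal ^ (m + 1) * v.asIdeal ^ (m + ν + 1)) ≤ rayClassField K (𝔤₀ * v'.asIdeal ^ ν * v'.asIdeal ^ (m + 2) * v.asIdeal ^ (m + ν + 1)) := rayClassField_le_of_le hB'0 (eB' ▸ Ideal.mul_le_right)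
  have hBC : rayClassField K (𝔤₀ * v'.asIdeal ^ ν * v'.asIdeal ^ (m + 1) * v.asIdeal ^ (m + ν + 2)) ≤ rayClassField K (𝔤₀ * v'.asIdeal ^ ν * v'.asIdeal ^ (m + 2) * v.asIdeal ^ (m + ν + 2)) := rayClassField_le_of_le hC0 (eCB ▸ Ideal.mul_le_right)
  have hB'C : rayClassField K (𝔤₀ * v'.asIdeal ^ ν * v'.asIdeal ^ (m + 2) * v.asIdeal ^ (m + ν + 1)) ≤ rayClassField K (𝔤₀ * v'.asIdeal ^ ν * v'.asIdeal ^ (m + 2) * v.asIdeal ^ (m + ν + 2)) := rayClassField_le_of_le hC0 (eCB' ▸ Ideal.mul_le_right)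
  -- `gcd(B, B') = A`
  have hvv'c : v.asIdeal ⊔ v'.asIdeal = ⊤ := v.isMaximal.coprime_of_ne v'.isMaximal fun e ↦ hvv' (HeightOneSpectrum.ext e).symm
  have hgcd : (𝔤₀ * v'.asIdeal ^ ν * v'.asIdeal ^ (m + 1) * v.asIdeal ^ (m + ν + 2)) ⊔ (𝔤₀ * v'.asIdeal ^ ν * v'.asIdeal ^ (m + 2) * v.asIdeal ^ (m + ν + 1)) = (𝔤₀ * v'.asIdeal ^ ν * v'.asIdeal ^ (m + 1) * v.asIdeal ^ (m + ν + 1)) := by rw [eB, eB', ← Ideal.mul_sup, hvv'c, Ideal.mul_top]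
  have hinf : rayClassField K (𝔤₀ * v'.asIdeal ^ ν * v'.asIdeal ^ (m + 1) * v.asIdeal ^ (m + ν + 2)) ⊓ rayClassField K (𝔤₀ * v'.asIdeal ^ ν * v'.asIdeal ^ (m + 2) * v.asIdeal ^ (m + ν + 1)) = rayClassField K (𝔤₀ * v'.asIdeal ^ ν * v'.asIdeal ^ (m + 1) * v.asIdeal ^ (m + ν + 1)) := by rw [rayClassField_inf hB0 hB'0, hgcd]
  have hp1 : (1 : ℕ) < 2 := by norm_num
  have hApos : 0 < Module.finrank K ↥(rayClassField K (𝔤₀ * v'.asIdeal ^ ν * v'.asIdeal ^ (m + 1) * v.asIdeal ^ (m + ν + 1))) := Module.finrank_pos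
  -- degrees
  refine ⟨finrank_eq_of_finrank_eq_mul hle (by rw [h3, h1]; ring), ?_⟩
  have h2T : (letI := (IntermediateField.inclusion hAB).toRingHom.toAlgebra; Module.finrank ↥(rayClassField K (𝔤₀ * v'.asIdeal ^ ν * v'.asIdeal ^ (m + 1) * v.asIdeal ^ (m + ν + 1))) ↥(rayClassField K (𝔤₀ * v'.asIdeal ^ ν * v'.asIdeal ^ (m + 1) * v.asIdeal ^ (m + ν + 2)))) ≤ 2 :=
    (finrank_eq_of_finrank_eq_mul hAB h1).le
  have h2T' : (letI := (IntermediateField.inclusion hAB').toRingHom.toAlgebra; Module.finrank ↥(rayClassField K (𝔤₀ * v'.asIdeal ^ ν * v'.asIdeal ^ (m + 1) * v.asIdeal ^ (m + ν + 1))) ↥(rayClassField K (𝔤₀ * v'.asIdeal ^ ν * v'.asIdeal ^ (m + 2) * v.asIdeal ^ (m + ν + 1)))) ≤ 2 :=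
    (finrank_eq_of_finrank_eq_mul hAB' h2).le
  -- `S_(m+1) = T ⊔ T'`
  have hsup : rayClassField K (𝔤₀ * v'.asIdeal ^ ν * v'.asIdeal ^ (m + 2) * v.asIdeal ^ (m + ν + 2)) ≤ rayClassField K (𝔤₀ * v'.asIdeal ^ ν * v'.asIdeal ^ (m + 1) * v.asIdeal ^ (m + ν + 2)) ⊔ rayClassField K (𝔤₀ * v'.asIdeal ^ ν * v'.asIdeal ^ (m + 2) * v.asIdeal ^ (m + ν + 1)) := by
    have hle' : rayClassField K (𝔤₀ * v'.asIdeal ^ ν * v'.asIdeal ^ (m + 1) * v.asIdeal ^ (m + ν + 2)) ⊔ rayClassField K (𝔤₀ * v'.asIdeal ^ ν * v'.asIdeal ^ (m + 2) * v.asIdeal ^ (m + ν + 1)) ≤ rayClassField K (𝔤₀ * v'.asIdeal ^ ν * v'.asIdeal ^ (m + 2) * v.asIdeal ^ (m + ν + 2)) := sup_le hBC hB'C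
    obtain ⟨r, hr⟩ : Module.finrank K ↥(rayClassField K (𝔤₀ * v'.asIdeal ^ ν * v'.asIdeal ^ (m + 1) * v.asIdeal ^ (m + ν + 2))) ∣ Module.finrank K ↥(rayClassField K (𝔤₀ * v'.asIdeal ^ ν * v'.asIdeal ^ (m + 1) * v.asIdeal ^ (m + ν + 2)) ⊔ rayClassField K (𝔤₀ * v'.asIdeal ^ ν * v'.asIdeal ^ (m + 2) * v.asIdeal ^ (m + ν + 1))) :=
      Dvd.intro _ (IntermediateField.finrank_bot_mul_relfinrank le_sup_left)
    have hdvd : Module.finrank K ↥(rayClassField K (𝔤₀ * v'.asIdeal ^ ν * v'.asIdeal ^ (m + 1) * v.asIdeal ^ (m + ν + 2)) ⊔ rayClassField K (𝔤₀ * v'.asIdeal ^ ν * v'.asIdeal ^ (m + 2) * v.asIdeal ^ (m + ν + 1))) ∣ Module.finrank K ↥(rayClassField K (𝔤₀ * v'.asIdeal ^ ν * v'.asIdeal ^ (m + 2) * v.asIdeal ^ (m + ν + 2))) :=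
      Dvd.intro _ (IntermediateField.finrank_bot_mul_relfinrank hle')
    rw [hr, h3, mul_comm 2] at hdvd
    have hBpos : 0 < Module.finrank K ↥(rayClassField K (𝔤₀ * v'.asIdeal ^ ν * v'.asIdeal ^ (m + 1) * v.asIdeal ^ (m + ν + 2))) := Module.finrank_pos
    have hr2 : r ∣ 2 := (Nat.mul_dvd_mul_iff_left hBpos).mp hdvd
    rcases (Nat.dvd_prime Nat.prime_two).mp hr2 with hr1 | hr2
    · -- `r = 1`: `T ⊔ T' = T`, so `T' ≤ T`, `T' = T`, `T = T ⊓ T' = S_m` — contradicts `[T : S_m] = 2`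
      exfalso
      rw [hr1, mul_one] at hr
      have e1 : rayClassField K (𝔤₀ * v'.asIdeal ^ ν * v'.asIdeal ^ (m + 1) * v.asIdeal ^ (m + ν + 2)) = rayClassField K (𝔤₀ * v'.asIdeal ^ ν * v'.asIdeal ^ (m + 1) * v.asIdeal ^ (m + ν + 2)) ⊔ rayClassField K (𝔤₀ * v'.asIdeal ^ ν * v'.asIdeal ^ (m + 2) * v.asIdeal ^ (m + ν + 1)) := IntermediateField.eq_of_le_of_finrank_eq le_sup_left hr.symm
      have hle2 : rayClassField K (𝔤₀ * v'.asIdeal ^ ν * v'.asIdeal ^ (m + 2) * v.asIdeal ^ (m + ν + 1)) ≤ rayClassField K (𝔤₀ * v'.asIdeal ^ ν * v'.asIdeal ^ (m + 1) * v.asIdeal ^ (m + ν + 2)) := e1 ▸ le_sup_right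
      have e2 : rayClassField K (𝔤₀ * v'.asIdeal ^ ν * v'.asIdeal ^ (m + 2) * v.asIdeal ^ (m + ν + 1)) = rayClassField K (𝔤₀ * v'.asIdeal ^ ν * v'.asIdeal ^ (m + 1) * v.asIdeal ^ (m + ν + 2)) := IntermediateField.eq_of_le_of_finrank_eq hle2 (by rw [h1, h2])
      rw [e2, inf_idem] at hinf
      have e3 : Module.finrank K ↥(rayClassField K (𝔤₀ * v'.asIdeal ^ ν * v'.asIdeal ^ (m + 1) * v.asIdeal ^ (m + ν + 2))) = Module.finrank K ↥(rayClassField K (𝔤₀ * v'.asIdeal ^ ν * v'.asIdeal ^ (m + 1) * v.asIdeal ^ (m + ν + 1))) := by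
        rw [hinf]
      omega
    · rw [hr2] at hr
      exact (IntermediateField.eq_of_le_of_finrank_eq hle' (by rw [hr, h3, mul_comm])).ge
  exact algEquiv_mul_self_eq_one_of_le_sup hle hAB hBC hAB' hB'C h2T h2T' hsup

end Tower

end Summit.BirchSwinnertonDyer.BirchSwinnertonDyer.Theorems.PrintCf2.BrickCD4Chi

end
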